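import Summits.BirchSwinnertonDyer.BirchSwinnertonDyer.Theorems.KolyvaginRankRigidityAtTwoSwapFromPiecesCoreFrobNine
import Summits.BirchSwinnertonDyer.BirchSwinnertonDyer.Theorems.KolyvaginRankRigidityAtTwoSwapAuxClassGlobalAtTwo
import Summits.BirchSwinnertonDyer.BirchSwinnertonDyer.Theorems.KolyvaginRankRigidityAtTwoSwapWeilDatumLiftChange
import Summits.BirchSwinnertonDyer.Rank1Residual.JET.TransverseFamilyConjAct
import Summits.BirchSwinnertonDyer.BirchSwinnertonDyer.Theorems.KolyvaginRankRigidityAtTwoTransversePackageAtTwo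
import Summits.BirchSwinnertonDyer.BirchSwinnertonDyer.Theorems.KolyvaginRankRigidityAtTwoTransverseClassAtTwo
import Summits.BirchSwinnertonDyer.BirchSwinnertonDyer.Theorems.KolyvaginRankRigidityAtTwoSwapPairingLowerBoundGlobal
import Summits.BirchSwinnertonDyer.BirchSwinnertonDyer.Theorems.KolyvaginRankRigidityAtTwoKolyvaginCorankLowerBoundAtTwoSelmerAwayFromConductor
import Summits.BirchSwinnertonDyer.BirchSwinnertonDyer.Theorems.GenusKolyvaginAtTwoKolyvaginRelationAtTwo
import HarnessLib

/-!
# Crux V2♭θ / V2♭∞ (stmt-BirchSwinnertonDyer-27220; line `kolyvagin_depth_split`), stub S1 — the prime swap at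
# 2 on a HYBRID-TRANSVERSE FRAME (II): `primeSwapAtTwoLossy_core_frob_nine` with P4, P5, P7, P8 and Q2 DISCHARGED

`primeSwapAtTwoLossy_core_hybrid_nine`: Kolyvagin's prime swap at `2` ([1] Prop. 8 = McCallum Prop. 5.2, lossy form,
conductor currency `n ↦ n / a · ℓ`) for a fixed frame `(Dt, β, ι)`, a `τ`-equivariant Weil datum per level,
conjugation-compatible perfect Poitou–Tate families per level, and per-level transverse structures `𝒯 M` that are
HYBRID (ring-class transverse condition at the Kolyvagin places of index `≥ M + 1`, Kummer elsewhere — hypotheses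
`hTko`, `hTku`), from ONLY:
* S2 `hS2` (landed, c₁) and the Poitou–Tate family's `SelmerComplement` (`hSC`, named-fact supplied);
* the named print fact `GrossLMS1991.prop37_2_frobeniusCongruence` (⇒ Q2 `KolyvaginRelationAtTwo`, p614530).
Discharged inside (all landed, `--supports` 27220): P8 `h𝒯sd` (`dualTransported_eq_of_hybrid`, p635686), P4 `hP4`
(`JET.localization_kolyvaginClass_mem_globalTransverse_two`, p636231 — unconditional), **P5** (width seat krr2-p2's
`exists_auxClass_large_at_two`, p635450, c₅ = 5, M ≥ 9; its `τ`-stability input from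
`JET.Walk.globalTransverse_conjActPlace_mem`, its adapted-lift Weil equivariance from `weil_equivariant_of_isLiftOfAut`,
p635772), P7a (`swapPairing_pow_smul_ne_zero_at_two`, p630197, c₇ = 2), P7b
(`pow_smul_localTatePairingZMod_eq_zero_of_hybrid`, c₇' = 0), T2 (`pow_zsmul_kolyvaginClass_two_mem_selmerLocalKer`,
t = |Δ_min| + 4). Constants: `c₀ = 2 (c₁ + |Δ_min| + 19)`, `c₂ = c₁ + 6`.
HONEST FRAMING: a composition — CONDITIONAL on Gross 1991 Prop. 3.7 (2) (and on the Poitou–Tate family handed in);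
nothing here proves S1, V2♭θ or BSD. [cite: Kolyvagin1991MathAnn, §2 Thm. 2.2, p. 257] [cite: McCallumLMS1991, §5 Prop. 5.2]
[cite: WZhang2014, Lemma 8.4] [cite: GrossLMS1991, Prop. 3.7 (2)]
-/

set_option autoImplicit false
set_option linter.dupNamespace false

noncomputable section

open scoped Classical Pointwise
open Function NumberField IsDedekindDomain WeierstrassCurve Field
open Literature.NumberTheory.EllipticCurves Literature.NumberTheory.GaloisRepresentations
open Literature.NumberTheory.EllipticCurves.Jetchev2008 Literature.NumberTheory.EllipticCurves.ModularForms
open Literature.NumberTheory.GaloisCohomology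
open Literature.NumberTheory.GaloisRepresentations.DiscreteGaloisModule (localTatePairingZMod
  tateDual transverseSubgroup SelmerStructure)
open Literature.NumberTheory.Automorphic
open Summit.BirchSwinnertonDyer.Rank1Residual
open Summit.BirchSwinnertonDyer.Rank1Residual.JET.SelmerVocabulary
open Summit.BirchSwinnertonDyer.Rank1Residual.JET.GlobalDuality
open Summit.BirchSwinnertonDyer.BirchSwinnertonDyer.Theses.KolyvaginRankRigidityAtTwo
open Summit.BirchSwinnertonDyer.BirchSwinnertonDyer.Theses.GenusKolyvaginAtTwo (KolyvaginRelationAtTwo)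
open Literature.NumberTheory.EllipticCurves.GrossLMS1991 (prop37_2_frobeniusCongruence)

namespace Summit.BirchSwinnertonDyer.BirchSwinnertonDyer.Theorems.KolyvaginLowerBoundAtTwo

section Frame

variable {K : Type} [Field K] [NumberField K] (W : WeierstrassCurve ℚ) [W.IsElliptic]
  [W.IsGloballyMinimal] [(W.baseChange K).IsElliptic] [NeZero (W.conductorNorm ℤ)]
  [∀ M : ℕ, NeZero (2 ^ M)] [∀ M : ℕ, Finite (geomTorsion (W.baseChange K) ((2 ^ M : ℕ) : ℤ))]
  (τ : K ≃ₐ[ℚ] K)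
  (Dt : ModularParametrizationData W (W.conductorNorm ℤ)) (β : ℤ) (ι : K →+* ℂ)
  [∀ j : ℕ, NumberField (ringClassField K ι j)]
  (e : ∀ M : ℕ, geomTorsion (W.baseChange K) ((2 ^ M : ℕ) : ℤ) →
    geomTorsion (W.baseChange K) ((2 ^ M : ℕ) : ℤ) → AlgebraicClosure K)
  (hμ : ∀ M S T, e M S T ^ (2 ^ M) = 1)
  (hadd₁ : ∀ M S₁ S₂ T, e M (S₁ + S₂) T = e M S₁ T * e M S₂ T)
  (hadd₂ : ∀ M S T₁ T₂, e M S (T₁ + T₂) = e M S T₁ * e M S T₂)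
  (hgal : ∀ M (g : absoluteGaloisGroup K) (S T : geomTorsion (W.baseChange K) ((2 ^ M : ℕ) : ℤ)),
    g • e M S T = e M (g • S) (g • T))
  (halt : ∀ M T, e M T T = 1) (hnondeg : ∀ M T, (∀ S, e M S T = 1) → T = 0)
  (hτe : ∀ (M : ℕ) S T, liftAut τ (e M S T) =
    e M ((isLiftOfAut_liftAut τ).torsionMap W ((2 ^ M : ℕ) : ℤ) S)
      ((isLiftOfAut_liftAut τ).torsionMap W ((2 ^ M : ℕ) : ℤ) T))
  (inv : ∀ M : ℕ, LocalInvariants K (2 ^ M))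
  (𝒯 : ∀ M : ℕ, SelmerStructure ((W.baseChange K).torsionGaloisModule ((2 ^ M : ℕ) : ℤ)))
  -- the habitat
  (hCM : ¬ W.HasCM) (hred : Rank1Residual.GoodOrd W 2 ∨ Rank1Residual.Mult W 2)
  (hsur : ∀ m : ℕ, W.HasSurjectiveModNGaloisRep (2 ^ m : ℕ)) (hK : IsImaginaryQuadratic K)
  (hne3 : NumberField.discr K ≠ -3) (hne4 : NumberField.discr K ≠ -4)
  (h2d : ¬ ((2 : ℤ) ∣ NumberField.discr K)) (hHN : SatisfiesHeegnerHypothesis (W.conductorNorm ℤ) K)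
  (hτ1 : τ ≠ 1) (hττ : τ * τ = 1)
  (hperf : ∀ M, (inv M).IsPerfect) (hvan : ∀ M, (inv M).SumLocalTermEqZero)
  (hinvc : ∀ M, (inv M).IsConjCompatible τ) (hSC : ∀ M, (inv M).SelmerComplement)
  -- the hybrid transverse structures: ring-class transverse at Kolyvagin places of index ≥ M + 1, Kummer elsewhere
  (hTko : ∀ (M : ℕ) (v : HeightOneSpectrum (𝓞 K)) (q : ℕ),
    Zhang2014.IsKolyvaginPrime (W.conductorNorm ℤ) W K 2 q → M + 1 ≤ Zhang2014.kolyvaginIndex W 2 q →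
    (q : 𝓞 K) ∈ v.asIdeal →
    𝒯 M (Sum.inr v) = ⨅ (w' : HeightOneSpectrum (𝓞 (ringClassField K ι q)))
        (_ : w'.asIdeal.LiesOver v.asIdeal),
        letI := (adicCompletionOfLiesOver K (ringClassField K ι q) v w').toAlgebra
        transverseSubgroup (GaloisRep.toLocal v ((W.baseChange K).torsionGaloisModule ((2 ^ M : ℕ) : ℤ)))
          (w'.adicCompletion (ringClassField K ι q)))
  (hTku : ∀ (M : ℕ) (v : HeightOneSpectrum (𝓞 K)),
    (¬ ∃ q : ℕ, Zhang2014.IsKolyvaginPrime (W.conductorNorm ℤ) W K 2 q ∧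
        M + 1 ≤ Zhang2014.kolyvaginIndex W 2 q ∧ (q : 𝓞 K) ∈ v.asIdeal) →
    𝒯 M (Sum.inr v) = (W.baseChange K).kummerSelmerStructure ((2 ^ M : ℕ) : ℤ) (Sum.inr v))
  -- Q2's print input (Gross 1991 Prop. 3.7 (2), image-free form)
  (h37 : prop37_2_frobeniusCongruence)
  -- S2 (landed, krr2-p2) for this frame
  {c₁ : ℕ}
  (hS2 : ∀ (n : ℕ) (dat : KolyvaginHeegnerData Dt β ι n) (M m I : ℕ),
    KolyvaginDescent.KolSupp (Zhang2014.IsKolyvaginPrime (W.conductorNorm ℤ) W K 2) n → 1 ≤ M →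
    (M : ℕ∞) ≤ Zhang2014.levelIndex W 2 n → M ≤ I → c₁ ≤ m →
    ((2 ^ m : ℕ) : ℤ) • dat.kolyvaginClass Nat.prime_two M ≠ 0 →
    ∀ X' : Finset ℕ, ∃ q : ℕ, q ∉ X' ∧ Zhang2014.IsKolyvaginPrime (W.conductorNorm ℤ) W K 2 q ∧
      I ≤ Zhang2014.kolyvaginIndex W 2 q ∧ ∃ v : HeightOneSpectrum (𝓞 K), ((q : ℕ) : 𝓞 K) ∈ v.asIdeal ∧
        ((2 ^ (m - c₁) : ℕ) : ℤ) • dat.kolyvaginClass Nat.prime_two M ∉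
          (W.baseChange K).torsionLocalKer (v.adicCompletion K) ((2 ^ M : ℕ) : ℤ))

include hμ hadd₁ hadd₂ hgal halt hnondeg hτe hCM hred hsur hK hne3 hne4 h2d hHN hτ1 hττ hperf hvan hinvc hSC hTko hTku h37
  hS2 in
/-- **The prime swap at `2` on a hybrid-transverse frame** (conductor currency; `c₀ = 2 (c₁ + |Δ_min| + 19)`,
`c₂ = c₁ + 6`): `primeSwapAtTwoLossy_core_frob_nine` with P4, P5, P7a, P7b, P8, Q2, T2 discharged by landed theorems —
CONDITIONAL on Gross 1991 Prop. 3.7 (2) (`h37`). [cite: Kolyvagin1991MathAnn, §2 Thm. 2.2, p. 257]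
[cite: McCallumLMS1991, §5 Prop. 5.2, Lemma 5.3] [cite: WZhang2014, Lemma 8.2, Lemma 8.4] -/
theorem primeSwapAtTwoLossy_core_hybrid_nine {M I j n a : ℕ} (X : Finset ℕ) (dat : KolyvaginHeegnerData Dt β ι n)
    (hM : 1 ≤ M) (hMI : M + 1 ≤ I) (hn : Squarefree n)
    (hnK : ∀ p ∈ n.primeFactors, Zhang2014.IsKolyvaginPrime (W.conductorNorm ℤ) W K 2 p ∧
      M + 1 ≤ Zhang2014.kolyvaginIndex W 2 p)
    (ha : a ∈ n.primeFactors)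
    (hj : M + 2 * (c₁ + 5 + 2 + 0 + ((minimalDiscriminantInt W).natAbs + 4) + 8) ≤ 2 * j)
    (hBig : ∀ X' : Finset ℕ, ∃ q : ℕ, q ∉ X' ∧ Zhang2014.IsKolyvaginPrime (W.conductorNorm ℤ) W K 2 q ∧
      I ≤ Zhang2014.kolyvaginIndex W 2 q ∧
      ∃ v : HeightOneSpectrum (𝓞 K), ((q : ℕ) : 𝓞 K) ∈ v.asIdeal ∧
        ((2 ^ j : ℕ) : ℤ) • dat.kolyvaginClass Nat.prime_two M ∉
          (W.baseChange K).torsionLocalKer (v.adicCompletion K) ((2 ^ M : ℕ) : ℤ)) :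
    ∃ ℓ : ℕ, ℓ ∉ X ∧ ℓ ∉ n.primeFactors ∧ Zhang2014.IsKolyvaginPrime (W.conductorNorm ℤ) W K 2 ℓ ∧
      I ≤ Zhang2014.kolyvaginIndex W 2 ℓ ∧ FrobEqFrobInfty W K (2 ^ I) ℓ ∧
      (∃ v : HeightOneSpectrum (𝓞 K), ((ℓ : ℕ) : 𝓞 K) ∈ v.asIdeal ∧
        ((2 ^ (j - (c₁ + 2 + 0 + 4)) : ℕ) : ℤ) • dat.kolyvaginClass Nat.prime_two M ∉
          (W.baseChange K).torsionLocalKer (v.adicCompletion K) ((2 ^ M : ℕ) : ℤ)) ∧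
      ∃ dat' : KolyvaginHeegnerData Dt β ι (n / a * ℓ),
        ∀ X' : Finset ℕ, ∃ q : ℕ, q ∉ X' ∧
          Zhang2014.IsKolyvaginPrime (W.conductorNorm ℤ) W K 2 q ∧
          I ≤ Zhang2014.kolyvaginIndex W 2 q ∧
          ∃ v : HeightOneSpectrum (𝓞 K), ((q : ℕ) : 𝓞 K) ∈ v.asIdeal ∧
            ((2 ^ (j - (c₁ + 2 + 0 + 4)) : ℕ) : ℤ) • dat'.kolyvaginClass Nat.prime_two M ∉
              (W.baseChange K).torsionLocalKer (v.adicCompletion K) ((2 ^ M : ℕ) : ℤ) := by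
  classical
  haveI : Fact (Nat.Prime 2) := ⟨Nat.prime_two⟩
  have hD : NumberField.discr K < -4 := X11b.KolyvaginAssembly.discr_lt_neg_four hK ⟨hne3, hne4⟩
  have hinj : ∀ (M : ℕ) (v : HeightOneSpectrum (𝓞 K)), Injective (inv M (Sum.inr v)) :=
    fun M v ↦ ((hperf M) v).1.injective
  -- P8: self-duality of the hybrid structure at every finite place
  have h𝒯sd : ∀ (M c : ℕ), ∀ v ∈ placesDividing K c,
      (inv M).dualTransported (𝒯 M) (weilDualIntertwining (W.baseChange K) (2 ^ M) (e M) (hμ M) (hadd₁ M)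
        (hadd₂ M) (hgal M)) (Sum.inr v) = 𝒯 M (Sum.inr v) := fun M c ↦
    dualTransported_eq_of_hybrid W M (e M) (hμ M) (hadd₁ M) (hadd₂ M) (hgal M) (halt M) (hnondeg M) (inv M)
      (𝒯 M) hK hD ι (hinj M) (fun v ↦ by
        by_cases h : ∃ q : ℕ, Zhang2014.IsKolyvaginPrime (W.conductorNorm ℤ) W K 2 q ∧
            M + 1 ≤ Zhang2014.kolyvaginIndex W 2 q ∧ (q : 𝓞 K) ∈ v.asIdeal
        · obtain ⟨q, hq, hMq, hqv⟩ := h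
          exact Or.inl ⟨q, hq, hMq, hqv, hTko M v q hq hMq hqv⟩
        · exact Or.inr (hTku M v h)) c
  -- P4: transversality at the primes of the conductor (unconditional at 2, margin one)
  have hP4 : ∀ (M c : ℕ) (dat : KolyvaginHeegnerData Dt β ι c),
      KolyvaginDescent.KolSupp (Zhang2014.IsKolyvaginPrime (W.conductorNorm ℤ) W K 2) c → 1 ≤ M →
      (∀ q ∈ c.primeFactors, M + 1 ≤ Zhang2014.kolyvaginIndex W 2 q) →
      ∀ w ∈ placesDividing K c,
        galoisCohomology.localization ((W.baseChange K).torsionGaloisModule ((2 ^ M : ℕ) : ℤ)) (Sum.inr w) 1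
          (dat.kolyvaginClass Nat.prime_two M) ∈ 𝒯 M (Sum.inr w) := by
    intro M c dat hc _ hcM w hw
    obtain ⟨𝒯g, h𝒯g, -⟩ := JET.Walk.exists_globalTransverseFamily W ι ((2 ^ M : ℕ) : ℤ)
    have hmem := JET.localization_kolyvaginClass_mem_globalTransverse_two W hK hD Dt β ι M h𝒯g dat hc hcM w hw
    -- the prime `q ∣ c` under `w`
    obtain ⟨q, hqc, hqw⟩ := (natCast_mem_iff_exists_primeFactor_mem hc.1.ne_zero w).mp
      ((mem_placesDividing_iff_natCast_mem hc.1.ne_zero w).mp hw)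
    rw [hTko M w q (hc.2 q hqc) (hcM q hqc) hqw, ← JET.Walk.globalTransverse_eq_of_natCast_mem h𝒯g w
      (Nat.prime_of_mem_primeFactors hqc) hqw]
    exact hmem
  -- τ-stability of the hybrid structure at the places of a Kolyvagin conductor (Gross §3 dihedral, via the global family)
  have h𝒯σ : ∀ (M m : ℕ), KolyvaginDescent.KolSupp (Zhang2014.IsKolyvaginPrime (W.conductorNorm ℤ) W K 2) m →
      (∀ q ∈ m.primeFactors, M + 1 ≤ Zhang2014.kolyvaginIndex W 2 q) →
      ∀ (v w : HeightOneSpectrum (𝓞 K)) (h : τ • v = w), v ∈ placesDividing K m →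
      ∀ x : galoisCohomology (((W.baseChange K).torsionGaloisModule ((2 ^ M : ℕ) : ℤ)).toLocal
        (Sum.inr v : Place K)) 1, x ∈ 𝒯 M (Sum.inr v) → conjActPlace W τ ((2 ^ M : ℕ) : ℤ) h x ∈ 𝒯 M (Sum.inr w) := by
    intro M m hm hmidx v w h hv x hx
    obtain ⟨𝒯g, h𝒯g, -⟩ := JET.Walk.exists_globalTransverseFamily W ι ((2 ^ M : ℕ) : ℤ)
    obtain ⟨q, hqm, hqv⟩ := (natCast_mem_iff_exists_primeFactor_mem hm.1.ne_zero v).mp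
      ((mem_placesDividing_iff_natCast_mem hm.1.ne_zero v).mp hv)
    have hq := hm.2 q hqm
    have hvv : τ • v = v := smul_place_eq_self_of_natCast_mem τ hq.1.ne_zero hq.2.2.2.2.1 v hqv
    have hvw : v = w := hvv.symm.trans h
    subst hvw
    have heq : 𝒯 M (Sum.inr v) = 𝒯g (Sum.inr v) := by
      rw [hTko M v q hq (hmidx q hqm) hqv, JET.Walk.globalTransverse_eq_of_natCast_mem h𝒯g v hq.1 hqv]
    rw [heq] at hx ⊢
    exact JET.Walk.globalTransverse_conjActPlace_mem h𝒯g τ hm.1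
      (JET.forall_conjActPlace_mem_of_eq_iInf_transverseSubgroup W hK ι τ _ m) v v h hv x hx
  -- P5 (width seat, c₅ = 5, M ≥ 9) on the hybrid structure
  have hP5 : ∀ (M m a : ℕ) (v₀ : HeightOneSpectrum (𝓞 K)) (s : ℤ), (s = 1 ∨ s = -1) → 9 ≤ M →
      KolyvaginDescent.KolSupp (Zhang2014.IsKolyvaginPrime (W.conductorNorm ℤ) W K 2) m →
      (∀ q ∈ m.primeFactors, M + 1 ≤ Zhang2014.kolyvaginIndex W 2 q) →
      Zhang2014.IsKolyvaginPrime (W.conductorNorm ℤ) W K 2 a → M + 1 ≤ Zhang2014.kolyvaginIndex W 2 a →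
      ¬ a ∣ m → ((a : ℕ) : 𝓞 K) ∈ v₀.asIdeal →
      ∃ w : galoisCohomology ((W.baseChange K).torsionGaloisModule ((2 ^ M : ℕ) : ℤ)) 1,
        w ∈ signPart W K τ ((2 ^ M : ℕ) : ℤ) s
          (((selmerF W ((2 ^ M : ℕ) : ℤ) (𝒯 M) (placesDividing K m)).relaxedAt {v₀}).selmerGroup) ∧
        ((2 ^ (M / 2 - 5) : ℕ) : ℤ) • w ≠ 0 := by
    intro M m a v₀ s hs hM9 hm hmidx ha hMa ham hv₀
    have hfix : τ • v₀ = v₀ := smul_place_eq_self_of_natCast_mem τ ha.1.ne_zero ha.2.2.2.2.1 v₀ hv₀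
    have hτe' : ∀ S T, liftAutPlace τ hfix (e M S T) =
        e M ((isLiftOfAut_liftAutPlace τ hfix).torsionMap W ((2 ^ M : ℕ) : ℤ) S)
          ((isLiftOfAut_liftAutPlace τ hfix).torsionMap W ((2 ^ M : ℕ) : ℤ) T) := fun S T ↦
      weil_equivariant_of_isLiftOfAut W ((2 ^ M : ℕ) : ℤ) (isLiftOfAut_liftAutPlace τ hfix) (isLiftOfAut_liftAut τ)
        (e M) (hgal M) (hτe M) S T
    exact exists_auxClass_large_at_two W τ M (e M) (hμ M) (hadd₁ M) (hadd₂ M) (hgal M) (halt M) (hnondeg M) (inv M)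
      (𝒯 M) hK hτ1 hττ (hperf M) (hvan M) (hSC M) (hinvc M) hM9 hm.1.ne_zero (h𝒯sd M m)
      (h𝒯σ M m hm hmidx) ha hMa ham v₀ hv₀ hfix hτe' hs
  -- P7a (global, c₇ = 2)
  have hP7a := swapPairing_pow_smul_ne_zero_at_two W τ e hμ hadd₁ hadd₂ hgal halt hnondeg inv hK hτ1 hττ hτe
    hinj hinvc
  -- P7b (c₇' = 0) from the package
  have hP7b : ∀ (M q : ℕ) (v : HeightOneSpectrum (𝓞 K))
      (w C : galoisCohomology ((W.baseChange K).torsionGaloisModule ((2 ^ M : ℕ) : ℤ)) 1) (s : ℤ) (a₀ b₀ : ℕ),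
      (s = 1 ∨ s = -1) → Zhang2014.IsKolyvaginPrime (W.conductorNorm ℤ) W K 2 q →
      M + 1 ≤ Zhang2014.kolyvaginIndex W 2 q → ((q : ℕ) : 𝓞 K) ∈ v.asIdeal →
      conjAct W τ ((2 ^ M : ℕ) : ℤ) w = s • w → conjAct W τ ((2 ^ M : ℕ) : ℤ) C = s • C →
      galoisCohomology.localization ((W.baseChange K).torsionGaloisModule ((2 ^ M : ℕ) : ℤ)) (Sum.inr v) 1 C ∈
        𝒯 M (Sum.inr v) →
      ((2 ^ a₀ : ℕ) : ℤ) • galoisCohomology.localization ((W.baseChange K).torsionGaloisModule ((2 ^ M : ℕ) : ℤ))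
        (Sum.inr v) 1 w ∈ 𝒯 M (Sum.inr v) →
      ((2 ^ b₀ : ℕ) : ℤ) • galoisCohomology.localization ((W.baseChange K).torsionGaloisModule ((2 ^ M : ℕ) : ℤ))
        (Sum.inr v) 1 C = 0 →
      (2 ^ (a₀ + b₀ + 0 - M) : ℕ) •
          localTatePairingZMod ((W.baseChange K).torsionGaloisModule ((2 ^ M : ℕ) : ℤ)) (2 ^ M) (Sum.inr v)
            (inv M (Sum.inr v))
            (galoisCohomology.localization ((W.baseChange K).torsionGaloisModule ((2 ^ M : ℕ) : ℤ)) (Sum.inr v) 1 w)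
            (galoisCohomology.localization (((W.baseChange K).torsionGaloisModule ((2 ^ M : ℕ) : ℤ)).tateDual (2 ^ M))
              (Sum.inr v) 1
              (galoisCohomology.map (weilDualIntertwining (W.baseChange K) (2 ^ M) (e M) (hμ M) (hadd₁ M) (hadd₂ M)
                (hgal M)) 1 C)) = 0 :=
    fun M q v w C s a₀ b₀ _ hq hMq hv _ _ hCT hwT hC0 ↦
      pow_smul_localTatePairingZMod_eq_zero_of_hybrid W M (e M) (hμ M) (hadd₁ M) (hadd₂ M) (hgal M) (hnondeg M)
        (inv M) (𝒯 M) hK hD ι (hinj M) v hq hMq hv (hTko M v q hq hMq hv) w C 0 hCT hwT hC0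
  -- Q2 by name from Gross 3.7 (2); T2 with t = |Δ_min| + 4
  have hQ2 : KolyvaginRelationAtTwo := GenusExact.kolyvaginRelationAtTwo_of_frobeniusCongruence h37
  have hT2 : ∀ (n : ℕ) (d : KolyvaginHeegnerData Dt β ι n) (M : ℕ),
      KolyvaginDescent.KolSupp (Zhang2014.IsKolyvaginPrime (W.conductorNorm ℤ) W K 2) n →
      1 ≤ M → (M : ℕ∞) ≤ Zhang2014.levelIndex W 2 n →
      ∀ v : HeightOneSpectrum (𝓞 K), ((n : ℕ) : 𝓞 K) ∉ v.asIdeal →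
        ((2 ^ ((minimalDiscriminantInt W).natAbs + 4) : ℕ) : ℤ) • d.kolyvaginClass Nat.prime_two M ∈
          selmerLocalKer (W.baseChange K) (v.adicCompletion K) ((2 ^ M : ℕ) : ℤ) :=
    fun n d M hn _ _ v hv ↦
      KolyvaginRankRigidity.pow_zsmul_kolyvaginClass_two_mem_selmerLocalKer W hK hHN hn.1.ne_zero d M v hv
  exact primeSwapAtTwoLossy_core_frob_nine (W := W) (τ := τ) (Dt := Dt) (β := β) (ι := ι) (e := e) (hμ := hμ)
    (hadd₁ := hadd₁) (hadd₂ := hadd₂) (hgal := hgal) (halt := halt) (hnondeg := hnondeg) (inv := inv)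
    (𝒯 := 𝒯) (hCM := hCM) (hred := hred) (hsur := hsur) (hK := hK) (hne3 := hne3) (hne4 := hne4)
    (h2d := h2d) (hHN := hHN) (hτ1 := hτ1) (hperf := hperf) (hvan := hvan) (h𝒯sd := h𝒯sd) (hP4 := hP4)
    (hP5 := hP5) (hP7a := hP7a) (hP7b := hP7b) (hQ2 := hQ2) (hT2 := hT2) (hS2 := hS2) X dat hM hMI hn hnK ha
    hj hBig

end Frame

end Summit.BirchSwinnertonDyer.BirchSwinnertonDyer.Theorems.KolyvaginLowerBoundAtTwo

end
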